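import Mathlib.Probability.Moments.Variance
import Mathlib.MeasureTheory.Integral.Prod
import Mathlib.MeasureTheory.Order.Group.Lattice
import HarnessLib

/-!
# Variance bookkeeping: differences, bounded variables, parametric integrals

Topic `Literature/Probability/Moments`.  Elementary inequalities for Mathlib's real variance
`ProbabilityTheory.variance` that are used over and over when a fluctuation statement is split
into pieces, stated so that Mathlib's junk conventions (`Var X = 0` for `X ∉ L²`) do not bite:

* `variance_sub_le_of_memLp`, `variance_sub_le`, `variance_sub_const_mul_le` — the parallelogram
  bound `Var(X − Y) ≤ 2 Var X + 2 Var Y` (`L²` case from `Var(X+Y) + Var(X−Y) = 2Var X + 2Var Y`;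
  robust case: `X ∈ L²` and `Y` merely a.e.-strongly measurable), and `Var(X − cY) ≤
  2 Var X + 2 c² Var Y`;
* `variance_le_sq_of_abs_le`, `memLp_two_of_abs_le` — `Var X ≤ B²` and `X ∈ L²` for `|X| ≤ B`
  a.e. (Popoviciu on `[-B, B]`);
* `variance_le_integral_sub_const_sq` — `Var X ≤ E[(X − c)²]` for every constant `c`;
* `variance_le_sq_add_sq_mul_measureReal` — the probability-to-`L²` bound
  `Var X ≤ δ² + K² · P(δ < |X − c|)` for `|X − c| ≤ K` a.e. (the converse bookkeeping to
  Chebyshev: smallness in probability of a BOUNDED variable gives smallness of the variance);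
* `sq_integral_le_integral_sq_of_abs_le` — Jensen `(∫ h dν)² ≤ ∫ h² dν` for bounded measurable
  `h` and a probability measure `ν`;
* `variance_integral_le_integral_integral_sq` — for probability measures `P, ν`, a bounded
  jointly measurable `F` and a bounded measurable centring `m`,
  `Var_P(ω ↦ ∫ F(ω, x) dν) ≤ ∫_x E_P[(F(·, x) − m x)²] dν`: the variance of a `ν`-average is at
  most the `ν`-average of the mean-square deviations (Jensen in `x`, Fubini).

## Mathlib

We USE `ProbabilityTheory.variance_fun_add` / `variance_fun_sub` (covariance algebra),
`variance_of_not_memLp`, `variance_const_mul`, `variance_le_sq_of_bounded` (Popoviciu),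
`variance_sub_const`, `variance_le_expectation_sq`, `variance_eq_sub`, `memLp_of_bounded`,
`Integrable.of_bound`, `StronglyMeasurable.integral_prod_right`, `integral_integral_swap`.
Mathlib has no Cauchy–Schwarz bound for `covariance` and none of the displayed inequalities as
such (searched `variance_sub`, `variance_add_le`, `variance_le`, `covariance_le`).

## References

* R. Durrett, *Probability: Theory and Examples*, 5th ed. (CUP 2019), §1.6 (variance algebra,
  Chebyshev's inequality) and §2.2 (`L²` weak laws).  [Durrett2019]
-/

noncomputable section

open MeasureTheory ProbabilityTheory Set Filter

namespace Literature.Probability.Moments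

variable {Ω : Type*} {mΩ : MeasurableSpace Ω} {μ : Measure Ω} {X Y : Ω → ℝ}

/-! ## Differences -/

/-- **Parallelogram bound for the variance of a difference**, `L²` case:
`Var(X − Y) ≤ 2 Var X + 2 Var Y` (from `Var(X+Y) + Var(X−Y) = 2 Var X + 2 Var Y` and
`Var(X+Y) ≥ 0`). [folklore] -/
theorem variance_sub_le_of_memLp [IsFiniteMeasure μ] (hX : MemLp X 2 μ) (hY : MemLp Y 2 μ) :
    ProbabilityTheory.variance (fun ω => X ω - Y ω) μ ≤
      2 * ProbabilityTheory.variance X μ + 2 * ProbabilityTheory.variance Y μ := by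
  have h1 := variance_fun_add hX hY
  have h2 := variance_fun_sub hX hY
  have h0 := variance_nonneg (fun ω => X ω + Y ω) μ
  linarith

/-- **Parallelogram bound for the variance of a difference**, robust form:
`Var(X − Y) ≤ 2 Var X + 2 Var Y` whenever `X ∈ L²` and `Y` is a.e.-strongly measurable (if
`Y ∉ L²` then `X − Y ∉ L²` and the left side is Mathlib's junk value `0`). [folklore] -/
theorem variance_sub_le [IsFiniteMeasure μ] (hX : MemLp X 2 μ) (hY : AEStronglyMeasurable Y μ) :
    ProbabilityTheory.variance (fun ω => X ω - Y ω) μ ≤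
      2 * ProbabilityTheory.variance X μ + 2 * ProbabilityTheory.variance Y μ := by
  by_cases hY2 : MemLp Y 2 μ
  · exact variance_sub_le_of_memLp hX hY2
  · have hXY : ¬ MemLp (fun ω => X ω - Y ω) 2 μ := by
      intro h
      apply hY2
      have h' : MemLp (fun ω => X ω - (X ω - Y ω)) 2 μ := hX.sub h
      simpa only [sub_sub_cancel] using h'
    rw [variance_of_not_memLp (X := fun ω => X ω - Y ω) (hX.aestronglyMeasurable.sub hY) hXY]
    exact add_nonneg (mul_nonneg zero_le_two (variance_nonneg _ _))
      (mul_nonneg zero_le_two (variance_nonneg _ _))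

/-- `Var(X − c·Y) ≤ 2 Var X + 2 c² Var Y` for `X ∈ L²`, `Y` a.e.-strongly measurable. [folklore] -/
theorem variance_sub_const_mul_le [IsFiniteMeasure μ] (hX : MemLp X 2 μ)
    (hY : AEStronglyMeasurable Y μ) (c : ℝ) :
    ProbabilityTheory.variance (fun ω => X ω - c * Y ω) μ ≤
      2 * ProbabilityTheory.variance X μ + 2 * c ^ 2 * ProbabilityTheory.variance Y μ := by
  have h := variance_sub_le hX (hY.const_mul c)
  rw [variance_const_mul] at h
  linarith

/-! ## Bounded variables -/

/-- `Var X ≤ B²` if `|X| ≤ B` a.e. (Popoviciu on `[-B, B]`). [folklore] -/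
theorem variance_le_sq_of_abs_le [IsProbabilityMeasure μ] {B : ℝ} (h : ∀ᵐ ω ∂μ, |X ω| ≤ B)
    (hX : AEMeasurable X μ) : ProbabilityTheory.variance X μ ≤ B ^ 2 := by
  have h' : ∀ᵐ ω ∂μ, X ω ∈ Set.Icc (-B) B := h.mono fun ω hω => abs_le.1 hω
  calc ProbabilityTheory.variance X μ ≤ ((B - -B) / 2) ^ 2 := variance_le_sq_of_bounded h' hX
    _ = B ^ 2 := by ring

/-- A.e.-bounded a.e.-strongly measurable functions are in `L²` of a finite measure. [folklore] -/
theorem memLp_two_of_abs_le [IsFiniteMeasure μ] {B : ℝ} (h : ∀ᵐ ω ∂μ, |X ω| ≤ B)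
    (hX : AEStronglyMeasurable X μ) : MemLp X 2 μ :=
  memLp_of_bounded (h.mono fun _ hω => abs_le.1 hω) hX 2

/-- `Var X ≤ E[(X − c)²]` for every constant `c` (the variance is the least mean-square deviation
from a constant). [folklore] -/
theorem variance_le_integral_sub_const_sq [IsProbabilityMeasure μ] (hX : AEStronglyMeasurable X μ)
    (c : ℝ) : ProbabilityTheory.variance X μ ≤ ∫ ω, (X ω - c) ^ 2 ∂μ := by
  rw [← variance_sub_const hX c]
  exact variance_le_expectation_sq (hX.sub aestronglyMeasurable_const)

/-- **`L²`-smallness from smallness in probability, for bounded observables** (the converse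
bookkeeping to Chebyshev; finite, no limits): if `|X − c| ≤ K` a.e. then for every real `δ`,
`Var X ≤ δ² + K² · P(δ < |X − c|)`. [folklore] -/
theorem variance_le_sq_add_sq_mul_measureReal [IsProbabilityMeasure μ] (hX : Measurable X)
    {c K : ℝ} (hK : ∀ᵐ ω ∂μ, |X ω - c| ≤ K) (δ : ℝ) :
    ProbabilityTheory.variance X μ ≤ δ ^ 2 + K ^ 2 * μ.real {ω | δ < |X ω - c|} := by
  have hS : MeasurableSet {ω | δ < |X ω - c|} :=
    measurableSet_lt measurable_const ((hX.sub_const c).abs)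
  have hpt : ∀ᵐ ω ∂μ, (X ω - c) ^ 2 ≤ δ ^ 2 + {ω | δ < |X ω - c|}.indicator (fun _ => K ^ 2) ω := by
    filter_upwards [hK] with ω hω
    by_cases h : δ < |X ω - c|
    · rw [Set.indicator_of_mem (by exact h)]
      have : (X ω - c) ^ 2 ≤ K ^ 2 := by
        rw [← sq_abs]; exact pow_le_pow_left₀ (abs_nonneg _) hω 2
      nlinarith [sq_nonneg δ]
    · rw [Set.indicator_of_notMem (by exact h), add_zero, ← sq_abs]
      exact pow_le_pow_left₀ (abs_nonneg _) (not_lt.1 h) 2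
  have hint : Integrable (fun ω => δ ^ 2 + {ω | δ < |X ω - c|}.indicator (fun _ => K ^ 2) ω) μ :=
    (integrable_const _).add ((integrable_const _).indicator hS)
  by_cases h2 : Integrable (fun ω => (X ω - c) ^ 2) μ
  · calc ProbabilityTheory.variance X μ ≤ ∫ ω, (X ω - c) ^ 2 ∂μ :=
          variance_le_integral_sub_const_sq hX.aestronglyMeasurable c
      _ ≤ ∫ ω, δ ^ 2 + {ω | δ < |X ω - c|}.indicator (fun _ => K ^ 2) ω ∂μ :=
          integral_mono_ae h2 hint hpt
      _ = δ ^ 2 + K ^ 2 * μ.real {ω | δ < |X ω - c|} := by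
          rw [integral_add (integrable_const _) ((integrable_const _).indicator hS),
            integral_const, integral_indicator_const _ hS, smul_eq_mul, smul_eq_mul, mul_comm]
          simp [mul_comm]
  · calc ProbabilityTheory.variance X μ ≤ ∫ ω, (X ω - c) ^ 2 ∂μ :=
          variance_le_integral_sub_const_sq hX.aestronglyMeasurable c
      _ = 0 := integral_undef h2
      _ ≤ δ ^ 2 + K ^ 2 * μ.real {ω | δ < |X ω - c|} := by positivity

/-! ## Parametric integrals -/

/-- `(∫ h dν)² ≤ ∫ h² dν` for a bounded measurable `h` and a probability measure `ν` (Jensen;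
here: `0 ≤ Var_ν h = ν[h²] − ν[h]²`). [folklore] -/
theorem sq_integral_le_integral_sq_of_abs_le {X : Type*} [MeasurableSpace X] {ν : Measure X}
    [IsProbabilityMeasure ν] {h : X → ℝ} (hh : Measurable h) {K : ℝ} (hK : ∀ x, |h x| ≤ K) :
    (∫ x, h x ∂ν) ^ 2 ≤ ∫ x, h x ^ 2 ∂ν := by
  have hmem : MemLp h 2 ν :=
    memLp_two_of_abs_le (Filter.Eventually.of_forall hK) hh.aestronglyMeasurable
  have hv := variance_eq_sub hmem
  have hv0 := variance_nonneg h ν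
  have : ∫ x, (h ^ 2) x ∂ν = ∫ x, h x ^ 2 ∂ν := rfl
  linarith

/-- **The variance of a `ν`-average is at most the `ν`-average of the mean-square deviations**:
for probability measures `μ`, `ν`, a jointly measurable bounded `F : Ω → X → ℝ` and any bounded
measurable centring `m : X → ℝ`,
`Var_μ(ω ↦ ∫ F(ω, x) dν) ≤ ∫_x ∫_ω (F(ω, x) − m x)² dμ dν` — so the variance of a parametric
integral tends to `0` as soon as the mean-square deviations do POINTWISE in the parameter
(dominated convergence in `x`), uniformly in anything entering only through a bounded weight.
[folklore] -/
theorem variance_integral_le_integral_integral_sq {X : Type*} [MeasurableSpace X]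
    [IsProbabilityMeasure μ] {ν : Measure X} [IsProbabilityMeasure ν] {F : Ω → X → ℝ}
    (hF : Measurable (Function.uncurry F)) {C : ℝ} (hC : ∀ ω x, |F ω x| ≤ C) {m : X → ℝ}
    (hm : Measurable m) {Cm : ℝ} (hCm : ∀ x, |m x| ≤ Cm) :
    ProbabilityTheory.variance (fun ω => ∫ x, F ω x ∂ν) μ ≤
      ∫ x, ∫ ω, (F ω x - m x) ^ 2 ∂μ ∂ν := by
  have hhm : Measurable (Function.uncurry fun ω x => F ω x - m x) := hF.sub (hm.comp measurable_snd)
  have hhb : ∀ ω x, |F ω x - m x| ≤ C + Cm := fun ω x =>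
    (abs_sub _ _).trans (add_le_add (hC ω x) (hCm x))
  have hY : StronglyMeasurable fun ω => ∫ x, F ω x ∂ν := hF.stronglyMeasurable.integral_prod_right
  have hFint : ∀ ω, Integrable (F ω) ν := fun ω =>
    Integrable.of_bound hF.of_uncurry_left.aestronglyMeasurable C
      (Filter.Eventually.of_forall fun x => by simpa only [Real.norm_eq_abs] using hC ω x)
  have hmint : Integrable m ν := Integrable.of_bound hm.aestronglyMeasurable Cm
    (Filter.Eventually.of_forall fun x => by simpa only [Real.norm_eq_abs] using hCm x)
  -- pointwise Jensen
  have hpt : ∀ ω, (∫ x, F ω x ∂ν - ∫ x, m x ∂ν) ^ 2 ≤ ∫ x, (F ω x - m x) ^ 2 ∂ν := fun ω => by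
    rw [← integral_sub (hFint ω) hmint]
    exact sq_integral_le_integral_sq_of_abs_le (hhm.of_uncurry_left (x := ω)) (hhb ω)
  -- integrability on the product
  have hprod : Integrable (Function.uncurry fun ω x => (F ω x - m x) ^ 2) (μ.prod ν) :=
    Integrable.of_bound (hhm.pow_const 2).aestronglyMeasurable ((C + Cm) ^ 2)
      (Filter.Eventually.of_forall fun p => by
        simp only [Function.uncurry, Real.norm_eq_abs, abs_pow]
        exact pow_le_pow_left₀ (abs_nonneg _) (hhb p.1 p.2) 2)
  calc ProbabilityTheory.variance (fun ω => ∫ x, F ω x ∂ν) μ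
      ≤ ∫ ω, (∫ x, F ω x ∂ν - ∫ x, m x ∂ν) ^ 2 ∂μ :=
        variance_le_integral_sub_const_sq hY.aestronglyMeasurable _
    _ ≤ ∫ ω, ∫ x, (F ω x - m x) ^ 2 ∂ν ∂μ :=
        integral_mono_of_nonneg (Filter.Eventually.of_forall fun ω => sq_nonneg _)
          hprod.integral_prod_left (Filter.Eventually.of_forall hpt)
    _ = ∫ x, ∫ ω, (F ω x - m x) ^ 2 ∂μ ∂ν := integral_integral_swap hprod

end Literature.Probability.Moments

end
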